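import Mathlib
import HarnessLib
import HarnessLib.Audit
import Summits.AtomisticToContinuum.Statement
import Literature.Analysis.FluidPDE.LinearizedHsEuler
import Summits.AtomisticToContinuum.HydrodynamicLimit.Theorems.AntiMazurCoboundariesHomogeneousInvariance
import HarnessLib.Audit.Status.Attr

/-!
Route: OneSphereInfluence

# Route OneSphereInfluence — Euler limit from the one-sphere influence of the initial local-Gibbs
data (score identity + Efron–Stein), glued to the conjunct

It suffices to show X = X_A ∧ X_B ∧ X_C, realising card one-particle-influence (spine; its crux 1 in
the DRESSED form its triage demanded),
now glued all the way to the conjunct (gen-2 of the retired route OneParticleInfluence, whose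
assembly stopped at the Literature constant).
Do calculus on the INITIAL local-Gibbs data of the deterministic system, not on the dynamics. X_A
(ScoreLinearResponse): along a pre-shock
homotopy κ ∈ [0,1] of profiles from a constant state to the target, Cov_{p_κ^N}(S_κ, ⟨U_N(t),χ⟩) →
∂_κ⟨U_κ(t),χ⟩ uniformly in κ, where
S_κ = Σ_i ∂_κ log(a_κ M_{u_κ,θ_κ})(z_i) is the score of the initial law; by the exact identity d/dκ
E_κ F_t = Cov_κ(S_κ, F_t) =
(N+1)·Cov_κ(s_κ(z₀), E_κ[F_t | z₀]) this is a statement about the conditional mean response of the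
fluid to ONE tagged sphere (its
hydrodynamic Green's function). X_B (ResamplingInfluence): resampling one sphere's initial state
moves the time-t field by o(N^{-1/2}) in L²,
Σ_i E Var(F_t | z_{−i}) → 0. X_C (HardCorePoincare): an N-uniform Poincaré/Efron–Stein inequality
for the canonical hard-core local Gibbs law
at small packing. Mean from X_A (FTC in κ, anchored at the flow-invariant constant state: supports
HomogeneousInvariance, PreShockHomotopy),
variance from X_C·X_B; together (glue MeanVarianceL2) they give the shared typed waypoint
L2HydroFields (target), and Chebyshev
gives the UNGUARDED Euler limit `Literature.MathematicalPhysics.KineticTheory.HydrodynamicLimit`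
(the cruxes carry no packing guard);
packaged as the rule-crux MeanVarianceReduction, the deciding theorem `closes` (crux-only, D-0027
§2.1) is
`HydrodynamicLimit.of_unguarded (hR h₂ h₃ h₄ hP)` — since the statement re-type of 2026-08-16
(D-0032, p126922) the conjunct
`_root_.HydrodynamicLimit` is the PACKING-GUARDED limit, implied by the unguarded one (the guard is
supplied vacuously).
Lean: `ScoreLinearResponse ∧ ResamplingInfluence ∧ HardCorePoincare`

## Assembly
Outer frame = pure logic: the deciding theorem (crux-only since the 2026-08-16 route repair, D-0027
§2.1; re-typed after the D-0032
statement re-type p126922 the same day) is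
`closes (h₂ : ScoreLinearResponse) (h₃ : ResamplingInfluence) (h₄ : HardCorePoincare) (hP :
PreShockHomotopy)
(hR : MeanVarianceReduction) : _root_.HydrodynamicLimit := _root_.HydrodynamicLimit.of_unguarded (hR
h₂ h₃ h₄ hP)` — every hypothesis
a crux. All mathematics sits in the items: the three one-sphere cruxes (ranks 2–4); the pre-shock
homotopy (crux: hyperbolic local theory
+ static LLN along the path); and ONE crux BY RULE, MeanVarianceReduction := ScoreLinearResponse →
ResamplingInfluence → HardCorePoincare →
PreShockHomotopy → Literature.MathematicalPhysics.KineticTheory.HydrodynamicLimit (the UNGUARDED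
limit — the route's glue, routine in
kind: score identity + FTC in κ + Efron–Stein variance bookkeeping ⇒ L2HydroFields (support
MeanVarianceL2, PROVED), then Chebyshev;
its proof is IN TREE, Theorems.oneSphereInfluence_meanVarianceReduction = the assembly theorem
oneSphereInfluence_assembly with the PROVED
HomogeneousInvariance discharged). Assembly (the four cruxes + HomogeneousInvariance ⇒ unguarded
limit) is the same statement with the
proved hypothesis explicit. RE-TYPE BOOKKEEPING (2026-08-16): `_root_.HydrodynamicLimit` is now the
packing-guarded conjunct (∃ η₀
outermost; guard ρ_t(x)σ³ < η₀ on [0,T)); by name the frame items Assembly / MeanVarianceReduction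
had silently become that weaker
statement, under which their landed proof scripts (`intro … a₁ θ₁ u₁ …`, no guard binder) no longer
elaborate — so both were RESTATED to
the unguarded conclusion they actually prove (the proof files compile unchanged; farm-checked
verbatim, SketchAssemblyU.lean rc 0) and
`closes` post-composes with the Statement's bridge `HydrodynamicLimit.of_unguarded`. The shared
support L2ToHydroLimit keeps the
by-name (guarded) conclusion; it is not in the deciding cone. StaticScoreResponse /
EquilibriumLinearResponse / OneParticleGreenResponse
are special cases / the sharp form of the rank-2 crux (footholds, not used by `closes`).

Rationale: WHY THIS LINE. The mechanism is Glauber calculus with respect to the RANDOM INITIAL DATA of a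
DETERMINISTIC particle system: the Glauber derivative
D_k F_t = F_t − E[F_t | z_{−k}] of the time-t macroscopic field is controlled in conditional mean
(X_A: hydrodynamic Green's-function response
to one tagged sphere) and in L² (X_B), and concentration comes from the spectral gap of the
"resample one sphere" dynamics of the initial Gibbs
law (X_C) — the architecture of Duerinckx2021 (arXiv:1912.01366 §2–3: Lemma 1 Efron–Stein, Prop. 1
sensitivity O(1/N), linearised Vlasov as
first-order response) for MEAN-FIELD Newton dynamics and of GloriaNeukammOtto2014 (vertical
derivative + spectral gap ⇒ fluctuation bounds)
in stochastic homogenisation, imported with the explicit dictionary: iid data ↦ canonical hard-core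
local Gibbs law (gap: Bertini2002 Thm 2.2,
doi:10.1016/j.jfa.2005.07.012, doi:10.1007/978-3-540-24587-2_68, HelmuthPerkinsPetti2022); pathwise
Grönwall sensitivity ↦ impossible here
((N+1)^{1/3} collisions per sphere per unit time, Lyapunov cascade) and replaced by CONDITIONAL-MEAN
/ L² sensitivity; linearised Vlasov ↦
linearised compressible hs-Euler (Spohn1991 §7.1 (7.13)–(7.19)); propagation of chaos for the mean ↦
a large-amplitude SCORE-IDENTITY
homotopy (likelihood-ratio sensitivity; LastPenrose2017 Thm 19.1 is the Poisson analogue). Imported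
areas: sensitivity analysis /
concentration for weakly dependent Gibbs fields (probability), Glauber spectral gaps of continuum
hard-core gases (MCMC / statistical
mechanics), linear response (nonequilibrium statistical mechanics, EvansMorriss2008 Ch. 5–7: van
Kampen's objection made the proof
obligation). What it does that the open routes do not: no relative-entropy method or classification
of stationary states (BGEndpointRigidity,
UGibbsSRBRigidity, VanishingNoise), no expansion in collision histories (AlphaScalingLadder,
CompensatedSlabClusters), no PDE-side selection
(BoxDissipativeWeakStrong, StrongClosureWeakBV): the closure problem is concentrated in two
statements about ONE particle, measured only in L²
of macroscopic observables, never pathwise (contrast Lanford1975 / BGSSAnnals2023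
pseudo-trajectories at Boltzmann–Grad).

RANKED CRUXES. #0 L2HydroFields (target) — the shared typed waypoint (signature of
stmt-AtomisticToContinuum-9057): for all continuous profiles ∃ σ₀ ∀ σ < σ₀ ∀ classical hs-Euler
solutions on [0,T) ∀ flows, if the local-Gibbs fields converge at t = 0 then for every t < T and
continuous χ the lower integrals of the squared deviations of the empirical density / momentum /
energy fields of Φ_t z from ∫χρ_t, ∫χρ_t u_t, ∫χE_t under localGibbsLaw tend to 0; this route enters
it through MeanVarianceL2; L2ToHydroLimit (Chebyshev) carries it to the conjunct. (why it might
fail: in substance the open conjunct itself (L² ⇔ in probability here, by energy conservation);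
deterministic spheres at fixed σ may fail to keep local equilibrium on Euler times (Spohn1991 I.3
"so far no proof").) [Spohn1991, OllaVaradhanYau1993]
#2 ScoreLinearResponse (crux) — SCORE LINEAR RESPONSE (card crux 1, integrated/dressed form): for
the target profile (a₁,u₁,θ₁), every Λ ≥ 1 and σ < σ₀(a₁,u₁,θ₁,Λ): along any smooth path κ ∈ [0,1]
of profiles (a_κ,u₀κ,θ₀κ) with constant start, endpoint (a₁,u₁,θ₁) and activities in the Λ-hull of
a₁, and any jointly smooth family of classical hs-Euler solutions U_κ on [0,T) whose data are the
LLN fields of the κ-profiles, for t < T and continuous χ: Cov_{p_κ^N}(S_κ, ⟨U_N(t),χ⟩) →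
∂_κ⟨U_κ(t),χ⟩ UNIFORMLY in κ ∈ [0,1] (density, momentum components, energy), S_κ(z) = Σ_i ∂_κ log
localGibbsProfile(a_κ,u₀κ,θ₀κ)(z_i) the score of the local Gibbs family. The exact finite-N identity
Cov_κ(S_κ,F) = d/dκ E_κ F and exchangeability make this (N+1)·Cov_κ(s_κ(z₀), E_κ[F_t | z₀]) — a
statement about the conditional mean response m_t(z₀) of the fluid to ONE tagged sphere (sharp form:
OneParticleGreenResponse). κ = 0 case = EquilibriumLinearResponse (Spohn1991 (7.19) in response
form); t = 0 case = StaticScoreResponse. A strict strengthening of the mean half of the conjunct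
along the homotopy (convergence of κ-derivatives) — a one-particle reformulation, not a reduction in
difficulty. [difficulty: open-problem] (why it might fail: open even at global equilibrium
(Spohn1991 (7.19): Euler-scale time correlations unproved for every deterministic model except hard
rods); an O(1) non-hydrodynamic memory of the tagged sphere surviving N^(1/3) collision times
(kinetic / ring modes) would add a non-Euler term to m_t.) [Spohn1991, Duerinckx2021,
arXiv:1912.01366, LastPenrose2017, EvansMorriss2008, Resibois1978]
#3 ResamplingInfluence (crux) — ONE-PARTICLE RESAMPLING INFLUENCE (card crux 2): for the target
local Gibbs law p_N, a pre-shock classical solution matching the data at t = 0, t < T and continuous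
χ: Σ_i E_p[Var_p(F_t | z_{−i})] → 0 for F_t = ⟨U_N(t),χ⟩ (density, momentum components, energy) —
resampling ONE sphere's initial state from its conditional law given the others moves the time-t
macroscopic field by o(N^{-1/2}) in L² (by exchangeability the sum is (N+1)·E|D₀F_t|²). Two-copy
comparison in L² of a macroscopic observable, never pathwise. Fluctuating-hydrodynamics bookkeeping:
the transported Euler-scale fluctuation changes by O(1/N), the cascade re-randomises only the
fast-current noise of Euler-scale size N^{-1/2}Kn^{1/2} = N^{-2/3}, so the sum is ≍ (N+1)·N^{-4/3} =
N^{-1/3} → 0; Efron–Stein's lower companion pins it ≥ Var F_t ≍ 1/N (window [N^{-1}, o(1)]).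
Mean-field analogue: Duerinckx2021 Prop. 1 (Grönwall). [difficulty: open-problem] (why it might
fail: if Euler-scale fluctuation fields are NOT deterministically transported by linearised Euler
(failure of Spohn1991 (7.13) for hard spheres), one resampled sphere re-randomises the whole
O(N^-1/2) fluctuation through the Lyapunov cascade and the sum stays O(1): crux false, conjunct
untouched.) [Spohn1991, Duerinckx2021, EfronStein1981, Chatterjee2016]
#4 HardCorePoincare (crux) — CANONICAL HARD-CORE POINCARÉ / EFRON–STEIN (card crux 3): for
continuous a₁ > 0 (any θ₁ > 0, u₁: velocities are conditionally independent Maxwellians) there is σ₀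
such that for σ < σ₀ the canonical local Gibbs law p_N of N+1 spheres of diameter σ(N+1)^(-1/3) on
𝕋³ satisfies Var_p(F) ≤ C Σ_i E_p[Var_p(F | z_{−i})] for all F ∈ L²(p_N), C uniform in N (and in the
flow label): an N-uniform spectral gap of the heat-bath 'resample one sphere' dynamics (Dirichlet
form Σ_i E Var(F|z_{−i})) of the CANONICAL INHOMOGENEOUS hard-core gas at small packing. In print:
products C = 1 (EfronStein1981); grand-canonical repulsive gas under (CE) (Bertini2002 Thm 2.2 p. 5)
and up to strong spatial mixing (arXiv:2601.18748 Thm 1.1); HOMOGENEOUS canonical hard spheres: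
spectral gap of the move-one-sphere dynamics at ρ ≤ (1−δ)/(3·2^{d+1})
(doi:10.1016/j.jfa.2005.07.012, cited arXiv:2601.18748 p. 3), rapid mixing at ρ ≤ (1−δ)/2^{d+1}
(doi:10.1007/978-3-540-24587-2_68), optimal mixing at low fugacity (HelmuthPerkinsPetti2022). Added
here: inhomogeneous activity in the Λ-hull, the (free) Maxwellian factor, N-dependent diameter at
fixed packing; N = 0 forces C ≥ 1. [difficulty: L] (why it might fail: hard core is the φ=+∞ limit
of Bertini2002's potentials and the ensemble is CANONICAL with inhomogeneous a(x): the fixed-N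
constraint couples all spheres at O(1/N), summed over N+1 resamplings this is O(1) — borderline for
an N-uniform constant unless the Bochner/path-coupling proof absorbs a(x).) [Bertini2002,
doi:10.1016/j.jfa.2005.07.012, doi:10.1007/978-3-540-24587-2_68, HelmuthPerkinsPetti2022,
arXiv:2601.18748, EfronStein1981]
#5 HomogeneousInvariance (support) — the canonical law with CONSTANT profiles (c, ū, θ̄) is
invariant under every hard-sphere flow, lawAt Φ p t = p for all t ∈ ℝ: its density 1_D Π_i
M_{ū,θ̄}(v_i)/Z is a function of kinetic energy and total momentum; Liouville preservation,
energy/momentum conservation along isTrajectory, invariance of `good` (goodᶜ Liouville-null) —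
PROVED cone facts; Z = 0 gives the zero measure, still invariant (refuter-checked TRUE for all
parameters as item 3073 of the retired route). Gives E_{p_0}[F_t] = E_{p_0}[F_0] at the κ = 0 end of
the homotopy. [difficulty: provable-now] [GST2013, CIP1994, Alexander1975]
#9 PreShockHomotopy (crux; re-kinded support, logically fourth) — PRE-SHOCK HOMOTOPY WITH
LOCAL-GIBBS MATCHING (card crux 4 + statics): for the target profile there are Λ ≥ 1 and σ₀ such
that for σ < σ₀, every classical hs-Euler solution (ρ,u,θ) on [0,T) whose data are the LLN fields of
(a₁,u₁,θ₁), every family of flows and every t < T, there is T' > t and a smooth path κ ↦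
(a_κ,u₀κ,θ₀κ) from constants to (a₁,u₁,θ₁) with activities in the Λ-hull of a₁, plus a jointly
smooth family of classical solutions on [0,T') with κ = 1 member (ρ,u,θ), constant κ = 0 member,
data = LLN fields of the κ-profiles, all laws probability measures (the exact hypothesis list of
ScoreLinearResponse). Splits into (i) PDE: smooth dependence on data (parameters as extra
variables), classical uniqueness and lower-semicontinuous life span for the symmetrisable hyperbolic
hs-Euler system (Kato1975, Majda1984 Thm 2.1–2.2), a path dodging earlier shocks (cool-and-slow
scaling (ρ,λu,λ²θ)(λt), exact for p = ρθZ(ρσ³), multiplies the life span by 1/λ; deform the profiles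
at small λ); (ii) statics: activity ↦ LLN density smooth with hull control at small packing (cluster
expansion, canonical ensemble), probability from isProbabilityMeasure_localGibbsLaw. Why it might
fail: its PDE half rests on the hyperbolic local theory (Kato1975, Majda1984) MISSING from the tree,
one σ₀ must serve every profile in the hull, the C^∞ gluing at κ = 1 needs a C^∞ activity↔density
map; the life span is not monotone along naive interpolation — only SOME path is claimed; T' ≤ T is
allowed. [difficulty: L] [Majda1984, Kato1975, Sideris1985, Dafermos2005, LebowitzPenrose1964]
#9 MeanVarianceReduction (crux BY RULE, D-0027 §2.1: the glue of the deciding chain; routine, M;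
RESTATED after the D-0032 re-type, stmt-17778) — ScoreLinearResponse → ResamplingInfluence →
HardCorePoincare → PreShockHomotopy → the UNGUARDED limit Literature…KineticTheory.HydrodynamicLimit
(`closes` adds HydrodynamicLimit.of_unguarded); = Assembly (stmt-17765) with the PROVED
HomogeneousInvariance discharged. PROOF IN TREE: Theorems.oneSphereInfluence_meanVarianceReduction
(MeanVarianceL2, PROVED: score identity + FTC in κ + Efron–Stein ⇒ L2HydroFields; then Chebyshev)
compiles unchanged against rev ≥ 6; re-close by citation. (why it might fail: only AS TYPED —
differentiation under the canonical integral, uniform integrability at κ = 0,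
covariance/condVar/derivWithin junk; already proved.) [LastPenrose2017, EfronStein1981,
Chatterjee2016, OllaVaradhanYau1993]
#9 StaticScoreResponse (support) — t = 0 case of ScoreLinearResponse (equilibrium statistical
mechanics only, no flow): along a smooth profile path with activities in the Λ-hull of a₁, if
ρ₀(κ,·) are the LLN density profiles (hypothesis), then Cov_{p_κ^N}(S_κ, ⟨U_N(0),χ⟩) → ∂_κ ∫χ·(ρ₀,
ρ₀u₀, ρ₀(|u₀|²/2 + 3θ₀/2))_κ uniformly in κ: differentiability of the canonical one-point density in
the activity profile, uniformly in N, at small packing (cluster expansion; canonical O(1/N)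
corrections and their κ-derivatives summed against the score); velocity parts are Gaussian. This is
the card's DRESSED static imprint m_0 integrated against the score. [difficulty: M] [Ruelle1969,
LebowitzPenrose1964, HelmuthPerkinsPetti2022, MichelenPerkins2022]
#9 EquilibriumLinearResponse (support) — GLOBAL-EQUILIBRIUM special case (κ = 0) of
ScoreLinearResponse: same hypotheses, conclusion only at κ = 0 where p_0 is the homogeneous
(flow-invariant) canonical Gibbs law: Cov_eq(Σ_i s_0(z_i), ⟨U_N(t),χ⟩) → ∂_κ|_0 ⟨U_κ(t),χ⟩ =
linearised hs-Euler about the constant state applied to the initial perturbation — the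
LINEAR-RESPONSE form of Spohn1991 §7.1 (7.19) / Landau–Placzek (Euler-scale equilibrium time
correlations transported by linearised Euler: sound + entropy/shear modes), open for every
deterministic model except hard rods; first foothold; MD check for refuters. [difficulty:
open-problem] [Spohn1991, EvansMorriss2008, Resibois1978]
#9 OneParticleGreenResponse (support) — ONE-PARTICLE GREEN'S-FUNCTION RESPONSE (the card's headline
object, typed now that defn-LinearizedHsEuler landed; foreseen layer-2 child of
ScoreLinearResponse): in the setting of ScoreLinearResponse, for t < T, continuous χ, k ∈ Fin 5 and
any κ-family ψ_κ of backward ADJOINT linearised hs-Euler solutions around U_κ on [0,t] with ψ_κ(t) =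
χ e_k, the conditional mean response of the time-t field to sphere 0, m_t(z₀) = E_κ[F^k_t | z₀] −
E_κ F^k_t, equals the time-0 conditional response tested against the back-propagated field, m̃_0(z₀)
= E_κ[⟨U_N(0), ψ_κ(0)⟩ | z₀] − E_κ⟨U_N(0), ψ_κ(0)⟩, up to o(1/N) in L²(p_κ): (N+1)²·E_κ|m_t − m̃_0|²
→ 0 uniformly in κ. By the PROVED duality ∫χV(t)_k = ∫⟪V(0),ψ(0)⟫ this is m_t = 𝒢^κ_t[m_0] + o(1/N):
the fluid remembers where one molecule started only through linearised-Euler (sound + entropy)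
transport of its DRESSED static imprint (the exact time-0 conditional response). With
StaticScoreResponse, Cauchy–Schwarz against the score, exchangeability and the proved
hasDerivWithinAt_integral_response it yields ScoreLinearResponse, given adjoint solvability (layer
2). Free flight fails it (ballistic memory of v₀). [difficulty: open-problem] [Spohn1991,
Duerinckx2021, EvansMorriss2008, AlderWainwright1970, Kato1975]
#9 MeanVarianceL2 (support) — THE GLUE OF THIS ROUTE (the content of the rule-crux
MeanVarianceReduction): take Λ from PreShockHomotopy and σ₀ = min of the four antecedents' σ₀; for σ
< σ₀, a classical solution on [0,T), flows Φ, the t = 0 hypothesis and t < T: PreShockHomotopy gives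
T' > t, the path and the Euler family with exactly the hypotheses of ScoreLinearResponse; the
finite-N SCORE IDENTITY d/dκ E_{p_κ}F_t = Cov_{p_κ}(S_κ, F_t) (Z_κ > 0 from the IsProbabilityMeasure
clause; differentiation under the integral with Gaussian domination, the hard-core indicator being
κ-independent), FTC in κ and the UNIFORM limit give E_{p_1}F_t − E_{p_0}F_t → ⟨U_1(t),χ⟩ −
⟨U_0(t),χ⟩; HomogeneousInvariance and the κ = 0 LLN at time 0 with uniform integrability (bounded χ,
Gaussian velocity moments, conserved kinetic energy) give E_{p_0}F_t = E_{p_0}F_0 → ⟨U_0(0),χ⟩ =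
⟨U_0(t),χ⟩ (constant member); HardCorePoincare (MemLp 2 by energy conservation) and
ResamplingInfluence give Var_{p_1}(F_t) → 0; E|F_t − c|² = Var + (E F_t − c)² → 0, as the lintegral
of ofReal(|·|²). Measure theory + one κ-integration. [difficulty: M] [Spohn1991,
OllaVaradhanYau1993, LastPenrose2017]
#9 L2ToHydroLimit (support) — Chebyshev/Markov in ℝ≥0∞ (shared stmt-9171; PROVED,
l2ToHydroLimit_proof_oneSphereInfluence): mean-square convergence ⇒ convergence in probability
binder-for-binder (meas_ge_le_lintegral_div, measurable_flow). By name now the GUARDED conjunct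
(guard unused; script needs `refine HydrodynamicLimit.of_unguarded ?_`); outside the deciding cone.
[difficulty: provable-now] [OllaVaradhanYau1993, Spohn1991]

TWO-LAYER PLAN. ScoreLinearResponse ⇐ OneParticleGreenResponse (typed support) → AdjointSolvability
(backward adjoint linearised hs-Euler solutions for smooth terminal data; Kato1975, Majda1984) →
CauchySchwarzGlue ((N+1)·‖s_κ‖_L²·o(1/N) → 0, StaticScoreResponse with vector test fields,
exchangeability, κ-equicontinuity, the PROVED hasDerivWithinAt_integral_response); or by regime:
EquilibriumLinearResponse → LocalEquilibriumExtension → ScoreLinearResponse. ResamplingInfluence ⇐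
TransportedPart (O(1/N)) → CascadeNoisePart (E|D₀η_t|² ≲ N^(-4/3)). PreShockHomotopy ⇐
DataSpaceHomotopy (pure PDE) → ActivityDensityInverse (statics). k ≤ 3 each, depth 1; nothing else
filed now.

KILL CRITERIA. ¬EquilibriumLinearResponse (Euler-scale equilibrium time correlations of hard spheres
at arbitrarily small packing NOT given by linearised
Euler) refutes ScoreLinearResponse: close `refuted:ScoreLinearResponse` and record it as a
summit-level negative (Spohn's fluctuation picture
fails for hard spheres). ¬ResamplingInfluence by a lower bound Σ_i E Var(F_t|z_−i) ≥ c > 0 at some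
fixed σ, t (full re-randomisation of the
thermal fluctuation by one sphere) kills the variance leg only: pivot by restating X_A for bounded
smooth G(F_t) (conditional-LAW response,
which absorbs the variance) or take the variance half of L2HydroFields from whichever route delivers
it (`superseded`). ¬HardCorePoincare (gap
→ 0 with N for the canonical hard-core law at small packing) forces a restate to a weaker
concentration inequality for symmetric Lipschitz
statistics of the initial data. A degenerate-instance refutation of PreShockHomotopy /
MeanVarianceReduction or a support (cf. negatives 9236/9238) is a misstatement ⇒ repaired item +
re-certified glue, not a close. L2HydroFields proved by any route moots the glue; the cruxes keep
independent interest as fluctuation theorems.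

NOT DECOMPOSED YET. The glue under the (typed) one-particle Green's-function statement — adjoint
solvability, Cauchy–Schwarz against the score,
κ-equicontinuity — which would make OneParticleGreenResponse → ScoreLinearResponse an item, the
split of ResamplingInfluence into transported part + cascade
noise, the PDE homotopy vs the activity↔density inverse map inside PreShockHomotopy, the finite-N
score identity / differentiation-under-the-
integral and uniform-integrability lemmas inside MeanVarianceL2 (provable now; provers attach them
with --supports MeanVarianceL2), any rate
in N (Kn^(1/2) = N^(-1/6) expected), d = 3 only, no claim past the first shock.

CHEAPEST FALSIFIER. (i) Free flight (the BoltzmannHypothesis kernel): Cov(S_0, F_t) is explicit and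
ballistic ≠ linearised Euler — the cruxes fail exactly where Euler fails (not a refutation at fixed
σ > 0: free flight is not a HardSphereFlow there). (ii) MD at packing
0.05–0.1 (kit): tagged-sphere ensemble, E[δρ(x,t) | x₀,v₀] must be a sound shell of radius ct plus a
heat mode carrying the dressed
(δN,δP,δE) with o(1/N) remainder, and (N+1)·E|D₀F_t|² must DEcrease with N (slope ≈ −1/3 in log-log)
— not run yet (a refuter should run it first). (iii) HardCorePoincare for N+1 = 2, 3 spheres on 𝕋³:
explicit gap of
the resample-one-sphere chain vs σ (kit-computable). (iv) Lookup done at open: the homogeneous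
canonical gap is in print (doi:10.1016/j.jfa.2005.07.012 at ρ ≤ (1−δ)/(3·2^{d+1}); KMM03 mixing at ρ
≤ (1−δ)/2^{d+1}; arXiv:2601.18748 p. 3) ⇒ HardCorePoincare is a 'variant', kept as the rank-4 crux:
the inhomogeneous canonical version on the N-dependent torus is load-bearing and not in print.

NUMBERS. Fixed reduced density (N+1)ε³ = σ³; collisions per sphere per unit time ≍ (N+1)^(1/3) (Kn ≍
N^(-1/3)); Efron–Stein budget: transported part
O(N^-2)·(N+1) = O(1/N), cascade noise O(N^-4/3)·(N+1) = O(N^-1/3); true Var(F_t) ≍ 1/N. Static gap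
thresholds (unit-volume spheres, ρ = packing):
canonical gap ρ ≤ (1−δ)/48 ≈ 0.021 (doi:10.1016/j.jfa.2005.07.012), canonical rapid mixing ρ ≤
(1−δ)/16 (KMM03), grand-canonical (CE) z < 1/(4π)
≈ 0.08 (Bertini2002 p. 5), grand-canonical gap up to λ < (1−δ)λ_SSM (arXiv:2601.18748 Thm 1.1); our
packing is πσ³/6 (σ = 0.3 ⇒ 0.014); freezing ≈ 0.49. VAF tail ∼ t^(-3/2) in d = 3
(AlderWainwright1970; integrable, O(Kn) correction). Items after the 2026-08-16 repair: 13 (1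
target, 5 cruxes, 6 support, 1 assembly).

DEFINITION REQUESTS. None open: defn-LinearizedHsEuler has LANDED
(Literature/Analysis/FluidPDE/LinearizedHsEuler.lean, LinearizedHsEulerDuality.lean,
LinearizedHsEulerFamily.lean; all proved) — imported here to type OneParticleGreenResponse. No cite
facts requested (the printed gaps are
grand-canonical or homogeneous: sources, not hypotheses). Foreseen later (a provable theorem, not a
definition): the hyperbolic local theory
(Kato1975, Majda1984) for PreShockHomotopy and adjoint solvability for smooth terminal data.

Novelty: Searches (2026-08-15, this session): `lit search --hybrid "tagged particle hydrodynamic response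
sound mode hard sphere fluid Green function
linear response"` (12 book rows, vector leg only: March–Tosi 1976, EvansMorriss2008 pp. 139–151 —
textbook linear response, nothing on the
deterministic limit); `lit search --hybrid "Efron-Stein influence of one particle initial data
deterministic particle system hydrodynamic
limit Glauber calculus sensitivity"` (12 rows, none relevant: KipnisLandim1999, Presutti2009); `lit
search --source crossref "Kannan Mahoney
Montenegro rapid mixing sphere packings canonical"` (doi:10.1007/978-3-540-24587-2_68); `lit search
--source crossref "Dai Pra Posta entropy
decay interacting systems Bochner Bakry Emery"` (doi:10.1214/ejp.v18-2041,
doi:10.1016/j.jfa.2005.07.012, doi:10.1214/08-aihp183); `lit read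
arxiv:2601.18748 --grep canonical|spectral gap` (p. 3 L18–19, p. 4 Thm 1.1, p. 8 Lemma 1.21); `lit
galaxy search "Glauber calculus" --star
all` (2 pdf hits: Bresch–Duerinckx–Jabin duality method for mean-field limits,
Miller–Nahmod–Pavlović–Rosenzweig–Staffilani Vlasov — both
mean-field); `lit galaxy search "hydrodynamic response to a tagged particle" | "Efron-Stein
inequality for Gibbs measures" --star all` (0);
`lit frontier AtomisticToContinuum --since 2022` (30 rows: nothing on one-particle influence / score
identities; nearest in spirit
arXiv:2310.13338 heat equation from a deterministic dynamics); `lit bridges AtomisticToContinuum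
--cross any`;  [refs: 10.1007/978-3-540-24587-2_68, 10.1214/ejp.v18-2041, 10.1016/j.jfa.2005.07.012, 10.1214/08-aihp183, 2601.18748, 2310.13338, 1912.01366, doi:10.1007/978-3-540-24587-2_68, doi:10.1214/ejp.v18-2041, doi:10.1016/j.jfa.2005.07.012, doi:10.1214/08-aihp183, arxiv:2601.18748, EvansMorriss2008, KipnisLandim1999, Duerinckx2021, Bertini2002, LastPenrose2017, Spohn1991, HelmuthPerkinsPetti2022, Lanford1975, BG]

Barriers (technique_class: score-identity efron-stein one-particle-influence): - technique_class: score-identity efron-stein one-particle-influence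
- Literature.Barriers.AtomisticToContinuum.BoltzmannHypothesisBarrier: not in its class (no entropy
method, no classification of stationary states of the infinite system); the closure input is
replaced by two one-particle response statements which visibly FAIL for the barrier's ideal-gas
kernel (free flight keeps ballistic memory of v₀, so Cov(S_0,F_t) is free transport, not linearised
Euler) — the cruxes carry the collisional content; honest residue: ScoreLinearResponse at κ = 0 is
Spohn's open fluctuation statement; the bet is that a one-particle, L², conditional-mean statement
is the smallest carrier of local equilibrium.
- Literature.Barriers.AtomisticToContinuum.NonAttractiveSystemsBarrier: a two-copy comparison is
used but NOT an order-preserving / monotone coupling — copies differ by one resampled sphere and are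
compared only through E|ΔF_t|² of a macroscopic observable (Efron–Stein), so the IsOrderPreservingOn
/ IsL1NonexpansiveOn equivalences (Temple, Crandall–Tartar) do not constrain it.
- Literature.Barriers.AtomisticToContinuum.NoDensityExpansionBarrier: evaded — σ fixed, no expansion
in density or in collision histories, no transport coefficient (Euler order); long-time tails enter
only as the integrable t^(-3/2) memory in why ScoreLinearResponse might fail.
- Literature.Barriers.AtomisticToContinuum.DiluteRegimeBarrier: evaded in form and substance — no
Boltzmann–Grad or joint limit, (N+1)ε³ =

History (route lifecycle, newest last):
- 2026-08-16T06:09:57Z · rev 2: restated Assembly (stmt-AtomisticToContinuum-13623) — ground repair (rground-AtomisticToContinuum-OneSphereI-e41e957b): the only flagged item was Assembly (stmt-13623, ground.trivial: `intros; aesop` closed it beca (planner-rground-AtomisticToContinuum-OneSphereI-e41e957b-0)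
- 2026-08-16T23:34:57Z · rev 5: restated Assembly (stmt-AtomisticToContinuum-14700 proved) — route-repair statement-revised (unit rrepair-AtomisticToContinuum-OneSphere-54bcc7f8, step 1/2 of the D-0032 re-type repair, p126922): RESTATE the frame item As (planner-rrepair-AtomisticToContinuum-OneSphere-54bcc7f8-0)
- 2026-08-16T23:35:54Z · rev 6: restated MeanVarianceReduction (stmt-AtomisticToContinuum-15139 proved) — route-repair statement-revised (unit rrepair-AtomisticToContinuum-OneSphere-54bcc7f8, step 2/2 of the D-0032 re-type repair, p126922): RESTATE the rule-crux Mea (planner-rrepair-AtomisticToContinuum-OneSphere-54bcc7f8-0)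

sub-problem: HydrodynamicLimit · status: draft · opened planner-plancard-AtomisticToContinuum-Hydrody-4e99ef50-g2-0 2026-08-15T19:02:31Z · rev 7 · ledger route-AtomisticToContinuum-OneSphereInfluence
GENERATED by the gate from the ledger (D-0016/17). Provers cite these decls: `theorem foo : Summit.AtomisticToContinuum.HydrodynamicLimit.Theses.OneSphereInfluence.<Decl> := …` in Summits/AtomisticToContinuum/HydrodynamicLimit/Theorems/<Name>.lean.
-/

namespace Summit.AtomisticToContinuum.HydrodynamicLimit.Theses.OneSphereInfluence

open scoped BigOperators Topology Manifold Classical MeasureTheory ProbabilityTheory Matrix InnerProductSpace ComplexConjugate ContinuousMap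
open Filter Set Function TopologicalSpace MeasureTheory

attribute [summit_statement] _root_.HydrodynamicLimit

/-- item stmt-AtomisticToContinuum-9057 · target · rank 0 · open · by planner
why it might fail: in substance the open conjunct itself (L² ⇔ in probability here, by energy conservation); deterministic spheres at fixed σ may fail to keep local equilibrium on Euler times (Spohn1991 I.3 "so far no proof").
sources: Spohn1991, OllaVaradhanYau1993
[support] SHARED TYPED WAYPOINT (item stmt-AtomisticToContinuum-0800 verbatim; target of routes
DenseKineticExpansion, DissipativeWeakStrong, OneParticleInfluence): mean-square convergence of the
three empirical fields at every t < T under the local Gibbs law; here the codomain of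
PayloadClosure. [difficulty: open-problem] -/
@[route_item "route-AtomisticToContinuum-OneSphereInfluence"]
def L2HydroFields : Prop :=
  ∀ (a₀ θ₀ : Literature.MathematicalPhysics.KineticTheory.T3 → ℝ) (u₀ : Literature.MathematicalPhysics.KineticTheory.T3 → Literature.MathematicalPhysics.KineticTheory.V3), Continuous a₀ → Continuous θ₀ → Continuous u₀ → (∀ x, 0 < a₀ x) → (∀ x, 0 < θ₀ x) → ∃ σ₀ : ℝ, 0 < σ₀ ∧ ∀ σ : ℝ, 0 < σ → σ < σ₀ → ∀ (T : ℝ) (ρ θ : ℝ → Literature.MathematicalPhysics.KineticTheory.T3 → ℝ) (u : ℝ → Literature.MathematicalPhysics.KineticTheory.T3 → Literature.MathematicalPhysics.KineticTheory.V3), Literature.MathematicalPhysics.KineticTheory.IsHardSphereEulerSolution σ T ρ u θ → ∀ Φ : (N : ℕ) → Literature.Analysis.FluidPDE.HardSphereFlow (Literature.Analysis.FluidPDE.Torus.geometry (Fin 3)) (Literature.MathematicalPhysics.KineticTheory.hsDiameter σ N) (N + 1), Literature.MathematicalPhysics.KineticTheory.TendstoHydroFieldsAt (fun N => Literature.MathematicalPhysics.KineticTheory.localGibbsLaw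 σ a₀ u₀ θ₀ N (Φ N)) Φ ρ u θ 0 → ∀ t ∈ Set.Ico 0 T, ∀ χ : Literature.MathematicalPhysics.KineticTheory.T3 → ℝ, Continuous χ → Filter.Tendsto (fun N : ℕ => ∫⁻ z, ENNReal.ofReal (|Literature.MathematicalPhysics.KineticTheory.empiricalDensityField ((Φ N).flow t z) χ - ∫ x, χ x * ρ t x| ^ 2) ∂(Literature.MathematicalPhysics.KineticTheory.localGibbsLaw σ a₀ u₀ θ₀ N (Φ N))) Filter.atTop (nhds 0) ∧ Filter.Tendsto (fun N : ℕ => ∫⁻ z, ENNReal.ofReal (‖Literature.MathematicalPhysics.KineticTheory.empiricalMomentumField ((Φ N).flow t z) χ - ∫ x, (χ x * ρ t x) • u t x‖ ^ 2) ∂(Literature.MathematicalPhysics.KineticTheory.localGibbsLaw σ a₀ u₀ θ₀ N (Φ N))) Filter.atTop (nhds 0) ∧ Filter.Tendsto (fun N : ℕ => ∫⁻ z, ENNReal.ofReal (|Literature.MathematicalPhysics.KineticTheory.empiricalEnergyField ((Φ N).flow t z) χ - ∫ x, χ x * Literature.MathematicalPhysics.KineticTheory.totalEnergyDensity (ρ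 t x) (u t x) (θ t x)| ^ 2) ∂(Literature.MathematicalPhysics.KineticTheory.localGibbsLaw σ a₀ u₀ θ₀ N (Φ N))) Filter.atTop (nhds 0)

/-- item stmt-AtomisticToContinuum-13617 · crux · rank 2 · open · by planner
why it might fail: open even at global equilibrium (Spohn1991 (7.19): Euler-scale time correlations unproved for every deterministic model except hard rods); an O(1) non-hydrodynamic memory of the tagged sphere surviving N^(1/3) collision times (kinetic / ring modes) would add a non-Euler term to m_t.
sources: Spohn1991, Duerinckx2021, arXiv:1912.01366, LastPenrose2017, EvansMorriss2008, Resibois1978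
[crux] SCORE LINEAR RESPONSE (card crux 1, integrated/dressed form): for the target profile
(a₁,u₁,θ₁), every Λ ≥ 1 and σ < σ₀(a₁,u₁,θ₁,Λ): along any smooth path κ ∈ [0,1] of profiles
(a_κ,u₀κ,θ₀κ) with constant start, endpoint (a₁,u₁,θ₁) and activities in the Λ-hull of a₁, and any
jointly smooth family of classical hs-Euler solutions U_κ on [0,T) whose data are the LLN fields of
the κ-profiles, for t < T and continuous χ: Cov_{p_κ^N}(S_κ, ⟨U_N(t),χ⟩) → ∂_κ⟨U_κ(t),χ⟩ UNIFORMLY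
in κ ∈ [0,1] (density, momentum components, energy), S_κ(z) = Σ_i ∂_κ log
localGibbsProfile(a_κ,u₀κ,θ₀κ)(z_i) the score of the local Gibbs family. The exact finite-N identity
Cov_κ(S_κ,F) = d/dκ E_κ F and exchangeability make this (N+1)·Cov_κ(s_κ(z₀), E_κ[F_t | z₀]) — a
statement about the conditional mean response m_t(z₀) of the fluid to ONE tagged sphere (sharp form:
OneParticleGreenResponse). κ = 0 case = EquilibriumLinearResponse (Spohn1991 (7.19) in response
form); t = 0 case = StaticScoreResponse. A strict strengthening of the mean half of the conjunct
along the homotopy (convergence of κ-derivatives) — a one-particle reformulation, not a reduction in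
difficulty. [difficulty: open-problem] -/
@[route_item "route-AtomisticToContinuum-OneSphereInfluence", crux]
def ScoreLinearResponse : Prop :=
  ∀ (a₁ θ₁ : Literature.MathematicalPhysics.KineticTheory.T3 → ℝ) (u₁ : Literature.MathematicalPhysics.KineticTheory.T3 → Literature.MathematicalPhysics.KineticTheory.V3), Continuous a₁ → Continuous θ₁ → Continuous u₁ → (∀ x, 0 < a₁ x) → (∀ x, 0 < θ₁ x) → ∀ Λ : ℝ, 1 ≤ Λ → ∃ σ₀ : ℝ, 0 < σ₀ ∧ ∀ σ : ℝ, 0 < σ → σ < σ₀ → ∀ (a θ₀ : ℝ → Literature.MathematicalPhysics.KineticTheory.T3 → ℝ) (u₀ : ℝ → Literature.MathematicalPhysics.KineticTheory.T3 → Literature.MathematicalPhysics.KineticTheory.V3), Literature.Analysis.FunctionSpaces.Torus.IsSmoothSpaceTimeOn (Set.Icc 0 1) a → Literature.Analysis.FunctionSpaces.Torus.IsSmoothSpaceTimeOn (Set.Icc 0 1) θ₀ → Literature.Analysis.FunctionSpaces.Torus.IsSmoothSpaceTimeOn (Set.Icc 0 1) u₀ → (∀ κ ∈ Set.Icc (0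 : ℝ) 1, ∀ x, Λ⁻¹ * (⨅ y, a₁ y) ≤ a κ x ∧ a κ x ≤ Λ * (⨆ y, a₁ y) ∧ 0 < θ₀ κ x) → (∀ x, a 0 x = a 0 0 ∧ θ₀ 0 x = θ₀ 0 0 ∧ u₀ 0 x = u₀ 0 0) → a 1 = a₁ → θ₀ 1 = θ₁ → u₀ 1 = u₁ → ∀ (T : ℝ) (ρ θ : ℝ → ℝ → Literature.MathematicalPhysics.KineticTheory.T3 → ℝ) (u : ℝ → ℝ → Literature.MathematicalPhysics.KineticTheory.T3 → Literature.MathematicalPhysics.KineticTheory.V3), (∀ κ ∈ Set.Icc (0 : ℝ) 1, Literature.MathematicalPhysics.KineticTheory.IsHardSphereEulerSolution σ T (ρ κ) (u κ) (θ κ)) → ContDiffOn ℝ ((⊤ : ℕ∞) : WithTop ℕ∞) (fun q : ℝ × ℝ × EuclideanSpace ℝ (Fin 3) => ρ q.1 q.2.1 (Literature.Analysis.FunctionSpaces.Torus.proj q.2.2)) (Set.Icc 0 1 ×ˢ (Set.Ico 0 T ×ˢ Set.univ)) → ContDiffOn ℝ ((⊤ : ℕ∞) : WithTop ℕ∞)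 (fun q : ℝ × ℝ × EuclideanSpace ℝ (Fin 3) => u q.1 q.2.1 (Literature.Analysis.FunctionSpaces.Torus.proj q.2.2)) (Set.Icc 0 1 ×ˢ (Set.Ico 0 T ×ˢ Set.univ)) → ContDiffOn ℝ ((⊤ : ℕ∞) : WithTop ℕ∞) (fun q : ℝ × ℝ × EuclideanSpace ℝ (Fin 3) => θ q.1 q.2.1 (Literature.Analysis.FunctionSpaces.Torus.proj q.2.2)) (Set.Icc 0 1 ×ˢ (Set.Ico 0 T ×ˢ Set.univ)) → ∀ Φ : (N : ℕ) → Literature.Analysis.FluidPDE.HardSphereFlow (Literature.Analysis.FluidPDE.Torus.geometry (Fin 3)) (Literature.MathematicalPhysics.KineticTheory.hsDiameter σ N) (N + 1), (∀ κ ∈ Set.Icc (0 : ℝ) 1, Literature.MathematicalPhysics.KineticTheory.TendstoHydroFieldsAt (fun N => Literature.MathematicalPhysics.KineticTheory.localGibbsLaw σ (a κ) (u₀ κ) (θ₀ κ) N (Φ N)) Φ (ρ κ) (u κ) (θ κ) 0) → ∀ t ∈ Set.Ico 0 T, ∀ χ : Literature.MathematicalPhysics.KineticTheory.T3 → ℝ,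 Continuous χ → let p : ℝ → (N : ℕ) → MeasureTheory.Measure (Literature.Analysis.FluidPDE.Config (N + 1) (Fin 3) Literature.MathematicalPhysics.KineticTheory.T3) := fun κ N => Literature.MathematicalPhysics.KineticTheory.localGibbsLaw σ (a κ) (u₀ κ) (θ₀ κ) N (Φ N); let S : ℝ → (N : ℕ) → Literature.Analysis.FluidPDE.Config (N + 1) (Fin 3) Literature.MathematicalPhysics.KineticTheory.T3 → ℝ := fun κ N z => ∑ i, derivWithin (fun κ' => Real.log (Literature.MathematicalPhysics.KineticTheory.localGibbsProfile (a κ') (u₀ κ') (θ₀ κ') (z i))) (Set.Icc 0 1) κ; TendstoUniformlyOn (fun N κ => ProbabilityTheory.covariance (S κ N) (fun z => Literature.MathematicalPhysics.KineticTheory.empiricalDensityField ((Φ N).flow t z) χ) (p κ N)) (fun κ => derivWithin (fun κ' => ∫ x, χ x * ρ κ' t x) (Set.Icc 0 1) κ) Filter.atTop (Set.Icc 0 1) ∧ (∀ j : Fin 3, TendstoUniformlyOn (fun N κ => ProbabilityTheory.covariance (S κ N) (fun z => Literature.MathematicalPhysics.KineticTheory.empiricalMomentumField ((Φ N).flow t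 z) χ j) (p κ N)) (fun κ => derivWithin (fun κ' => ∫ x, χ x * ρ κ' t x * u κ' t x j) (Set.Icc 0 1) κ) Filter.atTop (Set.Icc 0 1)) ∧ TendstoUniformlyOn (fun N κ => ProbabilityTheory.covariance (S κ N) (fun z => Literature.MathematicalPhysics.KineticTheory.empiricalEnergyField ((Φ N).flow t z) χ) (p κ N)) (fun κ => derivWithin (fun κ' => ∫ x, χ x * Literature.MathematicalPhysics.KineticTheory.totalEnergyDensity (ρ κ' t x) (u κ' t x) (θ κ' t x)) (Set.Icc 0 1) κ) Filter.atTop (Set.Icc 0 1)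

/-- item stmt-AtomisticToContinuum-13618 · crux · rank 3 · open · by planner
why it might fail: if Euler-scale fluctuation fields are NOT deterministically transported by linearised Euler (failure of Spohn1991 (7.13) for hard spheres), one resampled sphere re-randomises the whole O(N^-1/2) fluctuation through the Lyapunov cascade and the sum stays O(1): crux false, conjunct untouched.
sources: Spohn1991, Duerinckx2021, EfronStein1981, Chatterjee2016
[crux] ONE-PARTICLE RESAMPLING INFLUENCE (card crux 2): for the target local Gibbs law p_N, a
pre-shock classical solution matching the data at t = 0, t < T and continuous χ: Σ_i E_p[Var_p(F_t |
z_{−i})] → 0 for F_t = ⟨U_N(t),χ⟩ (density, momentum components, energy) — resampling ONE sphere's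
initial state from its conditional law given the others moves the time-t macroscopic field by
o(N^{-1/2}) in L² (by exchangeability the sum is (N+1)·E|D₀F_t|²). Two-copy comparison in L² of a
macroscopic observable, never pathwise. Fluctuating-hydrodynamics bookkeeping: the transported
Euler-scale fluctuation changes by O(1/N), the cascade re-randomises only the fast-current noise of
Euler-scale size N^{-1/2}Kn^{1/2} = N^{-2/3}, so the sum is ≍ (N+1)·N^{-4/3} = N^{-1/3} → 0;
Efron–Stein's lower companion pins it ≥ Var F_t ≍ 1/N (window [N^{-1}, o(1)]). Mean-field analogue:
Duerinckx2021 Prop. 1 (Grönwall, unavailable here). [difficulty: open-problem] -/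
@[route_item "route-AtomisticToContinuum-OneSphereInfluence", crux]
def ResamplingInfluence : Prop :=
  ∀ (a₁ θ₁ : Literature.MathematicalPhysics.KineticTheory.T3 → ℝ) (u₁ : Literature.MathematicalPhysics.KineticTheory.T3 → Literature.MathematicalPhysics.KineticTheory.V3), Continuous a₁ → Continuous θ₁ → Continuous u₁ → (∀ x, 0 < a₁ x) → (∀ x, 0 < θ₁ x) → ∃ σ₀ : ℝ, 0 < σ₀ ∧ ∀ σ : ℝ, 0 < σ → σ < σ₀ → ∀ (T : ℝ) (ρ θ : ℝ → Literature.MathematicalPhysics.KineticTheory.T3 → ℝ) (u : ℝ → Literature.MathematicalPhysics.KineticTheory.T3 → Literature.MathematicalPhysics.KineticTheory.V3), Literature.MathematicalPhysics.KineticTheory.IsHardSphereEulerSolution σ T ρ u θ → ∀ Φ : (N : ℕ) → Literature.Analysis.FluidPDE.HardSphereFlow (Literature.Analysis.FluidPDE.Torus.geometry (Fin 3)) (Literature.MathematicalPhysics.KineticTheory.hsDiameter σ N) (N + 1), Literature.MathematicalPhysics.KineticTheory.TendstoHydroFieldsAt (fun N => Literature.MathematicalPhysics.KineticTheory.localGibbsLaw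 σ a₁ u₁ θ₁ N (Φ N)) Φ ρ u θ 0 → ∀ t ∈ Set.Ico 0 T, ∀ χ : Literature.MathematicalPhysics.KineticTheory.T3 → ℝ, Continuous χ → let p : (N : ℕ) → MeasureTheory.Measure (Literature.Analysis.FluidPDE.Config (N + 1) (Fin 3) Literature.MathematicalPhysics.KineticTheory.T3) := fun N => Literature.MathematicalPhysics.KineticTheory.localGibbsLaw σ a₁ u₁ θ₁ N (Φ N); let m : (N : ℕ) → Fin (N + 1) → MeasurableSpace (Literature.Analysis.FluidPDE.Config (N + 1) (Fin 3) Literature.MathematicalPhysics.KineticTheory.T3) := fun N i => MeasurableSpace.comap (fun (z : Literature.Analysis.FluidPDE.Config (N + 1) (Fin 3) Literature.MathematicalPhysics.KineticTheory.T3) (j : Fin N) => z (i.succAbove j)) MeasurableSpace.pi; Filter.Tendsto (fun N : ℕ => ∑ i : Fin (N + 1), ∫ z, ProbabilityTheory.condVar (m N i) (fun z => Literature.MathematicalPhysics.KineticTheory.empiricalDensityField ((Φ N).flow t z) χ) (p N) z ∂(p N)) Filter.atTop (nhds 0) ∧ (∀ j : Fin 3, Filter.Tendsto (fun N : ℕ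 => ∑ i : Fin (N + 1), ∫ z, ProbabilityTheory.condVar (m N i) (fun z => Literature.MathematicalPhysics.KineticTheory.empiricalMomentumField ((Φ N).flow t z) χ j) (p N) z ∂(p N)) Filter.atTop (nhds 0)) ∧ Filter.Tendsto (fun N : ℕ => ∑ i : Fin (N + 1), ∫ z, ProbabilityTheory.condVar (m N i) (fun z => Literature.MathematicalPhysics.KineticTheory.empiricalEnergyField ((Φ N).flow t z) χ) (p N) z ∂(p N)) Filter.atTop (nhds 0)

/-- item stmt-AtomisticToContinuum-13619 · crux · rank 4 · closed · proved by Summit.AtomisticToContinuum.HydrodynamicLimit.Theorems.HardCorePoincareDobrushin.hardCorePoincare_holds (prover) · by planner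
why it might fail: hard core is the φ=+∞ limit of Bertini2002's potentials and the ensemble is CANONICAL with inhomogeneous a(x): the fixed-N constraint couples all spheres at O(1/N), summed over N+1 resamplings this is O(1) — borderline for an N-uniform constant unless the Bochner/path-coupling proof absorbs a(x).
sources: Bertini2002, doi:10.1016/j.jfa.2005.07.012, doi:10.1007/978-3-540-24587-2_68, HelmuthPerkinsPetti2022, arXiv:2601.18748, EfronStein1981
[crux] CANONICAL HARD-CORE POINCARÉ / EFRON–STEIN (card crux 3): for continuous a₁ > 0 (any θ₁ > 0,
u₁: velocities are conditionally independent Maxwellians) there is σ₀ such that for σ < σ₀ the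
canonical local Gibbs law p_N of N+1 spheres of diameter σ(N+1)^(-1/3) on 𝕋³ satisfies Var_p(F) ≤ C
Σ_i E_p[Var_p(F | z_{−i})] for all F ∈ L²(p_N), C uniform in N (and in the flow label, which the law
ignores): an N-uniform spectral gap of the heat-bath 'resample one sphere' dynamics (Dirichlet form
Σ_i E Var(F|z_{−i})) of the CANONICAL INHOMOGENEOUS hard-core gas at small packing. In print:
products C = 1 (EfronStein1981); grand-canonical repulsive gas under (CE) (Bertini2002 Thm 2.2 p. 5)
and up to strong spatial mixing (arXiv:2601.18748 Thm 1.1); HOMOGENEOUS canonical hard spheres: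
spectral gap of the move-one-sphere dynamics at ρ ≤ (1−δ)/(3·2^{d+1})
(doi:10.1016/j.jfa.2005.07.012, cited arXiv:2601.18748 p. 3), rapid mixing at ρ ≤ (1−δ)/2^{d+1}
(doi:10.1007/978-3-540-24587-2_68), optimal mixing at low fugacity (HelmuthPerkinsPetti2022). Added
here: inhomogeneous activity in the Λ-hull, the (free) Maxwellian factor, N-dependent diameter at
fixed packing; N = 0 forces C ≥ 1. Only the targe -/
@[route_item "route-AtomisticToContinuum-OneSphereInfluence", crux]
def HardCorePoincare : Prop :=
  ∀ (a₁ θ₁ : Literature.MathematicalPhysics.KineticTheory.T3 → ℝ) (u₁ : Literature.MathematicalPhysics.KineticTheory.T3 → Literature.MathematicalPhysics.KineticTheory.V3), Continuous a₁ → Continuous θ₁ → Continuous u₁ → (∀ x, 0 < a₁ x) → (∀ x, 0 < θ₁ x) → ∃ σ₀ : ℝ, 0 < σ₀ ∧ ∀ σ : ℝ, 0 < σ → σ < σ₀ → ∃ C : ℝ, 0 < C ∧ ∀ (N : ℕ) (Φ : Literature.Analysis.FluidPDE.HardSphereFlow (Literature.Analysis.FluidPDE.Torus.geometry (Fin 3))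 (Literature.MathematicalPhysics.KineticTheory.hsDiameter σ N) (N + 1)) (F : Literature.Analysis.FluidPDE.Config (N + 1) (Fin 3) Literature.MathematicalPhysics.KineticTheory.T3 → ℝ), MeasureTheory.MemLp F 2 (Literature.MathematicalPhysics.KineticTheory.localGibbsLaw σ a₁ u₁ θ₁ N Φ) → ProbabilityTheory.variance F (Literature.MathematicalPhysics.KineticTheory.localGibbsLaw σ a₁ u₁ θ₁ N Φ) ≤ C * ∑ i : Fin (N + 1), ∫ z, ProbabilityTheory.condVar (MeasurableSpace.comap (fun (z : Literature.Analysis.FluidPDE.Config (N + 1) (Fin 3) Literature.MathematicalPhysics.KineticTheory.T3) (j : Fin N) => z (i.succAbove j)) MeasurableSpace.pi) F (Literature.MathematicalPhysics.KineticTheory.localGibbsLaw σ a₁ u₁ θ₁ N Φ) z ∂(Literature.MathematicalPhysics.KineticTheory.localGibbsLaw σ a₁ u₁ θ₁ N Φ)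

-- `HardCorePoincare` holds: proved by `Summit.AtomisticToContinuum.HydrodynamicLimit.Theorems.HardCorePoincareDobrushin.hardCorePoincare_holds` (its module imports this route file, so no `_holds` link can be stated here).

/-- item stmt-AtomisticToContinuum-13621 · crux · rank 9 · closed · proved by Summit.AtomisticToContinuum.HydrodynamicLimit.Theorems.PreShockDoor.preShockHomotopy_holds (prover) · by planner
why it might fail: Composite: the PDE half rests on the MISSING hyperbolic local theory (Kato1975, Majda1984 Thm 2.1-2.2: smooth parameter dependence, l.s.c. life span) for a jointly C^inf family on [0,T'), T'>t; statics need ONE sigma0 uniform over the hull + a C^inf activity-density map (near localGibbs_lln_holds).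
sources: Kato1975, Majda1984, Sideris1985, Dafermos2005 Thm 5.1.1, LebowitzPenrose1964, Spohn1991
[support] PRE-SHOCK HOMOTOPY WITH LOCAL-GIBBS MATCHING (card crux 4 + statics): for the target
profile there are Λ ≥ 1 and σ₀ such that for σ < σ₀, every classical hs-Euler solution (ρ,u,θ) on
[0,T) whose data are the LLN fields of (a₁,u₁,θ₁), every family of flows and every t < T, there is
T' > t and a smooth path κ ↦ (a_κ,u₀κ,θ₀κ) from constants to (a₁,u₁,θ₁) with activities in the
Λ-hull of a₁, plus a jointly smooth family of classical solutions on [0,T') with κ = 1 member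
(ρ,u,θ), constant κ = 0 member, data = LLN fields of the κ-profiles, all laws probability measures
(the exact hypothesis list of ScoreLinearResponse). Splits into (i) PDE: smooth dependence on data
(parameters as extra variables), classical uniqueness and lower-semicontinuous life span for the
symmetrisable hyperbolic hs-Euler system (Kato1975, Majda1984 Thm 2.1–2.2), a path dodging earlier
shocks (cool-and-slow scaling (ρ,λu,λ²θ)(λt), exact for p = ρθZ(ρσ³), multiplies the life span by
1/λ; deform the profiles at small λ); (ii) statics: activity ↦ LLN density smooth with hull control
at small packing (cluster expansion, canonical ensemble), probability from
isProbabilityMeasure_localGibbsLaw. Why it might fai -/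
@[route_item "route-AtomisticToContinuum-OneSphereInfluence", crux]
def PreShockHomotopy : Prop :=
  ∀ (a₁ θ₁ : Literature.MathematicalPhysics.KineticTheory.T3 → ℝ) (u₁ : Literature.MathematicalPhysics.KineticTheory.T3 → Literature.MathematicalPhysics.KineticTheory.V3), Continuous a₁ → Continuous θ₁ → Continuous u₁ → (∀ x, 0 < a₁ x) → (∀ x, 0 < θ₁ x) → ∃ Λ : ℝ, 1 ≤ Λ ∧ ∃ σ₀ : ℝ, 0 < σ₀ ∧ ∀ σ : ℝ, 0 < σ → σ < σ₀ → ∀ (T : ℝ) (ρ θ : ℝ → Literature.MathematicalPhysics.KineticTheory.T3 → ℝ) (u : ℝ → Literature.MathematicalPhysics.KineticTheory.T3 → Literature.MathematicalPhysics.KineticTheory.V3), Literature.MathematicalPhysics.KineticTheory.IsHardSphereEulerSolution σ T ρ u θ → ∀ Φ : (N : ℕ) → Literature.Analysis.FluidPDE.HardSphereFlow (Literature.Analysis.FluidPDE.Torus.geometry (Fin 3)) (Literature.MathematicalPhysics.KineticTheory.hsDiameter σ N) (N + 1), Literature.MathematicalPhysics.KineticTheory.TendstoHydroFieldsAt (fun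 N => Literature.MathematicalPhysics.KineticTheory.localGibbsLaw σ a₁ u₁ θ₁ N (Φ N)) Φ ρ u θ 0 → ∀ t ∈ Set.Ico 0 T, ∃ T' : ℝ, t < T' ∧ ∃ (a θ₀ : ℝ → Literature.MathematicalPhysics.KineticTheory.T3 → ℝ) (u₀ : ℝ → Literature.MathematicalPhysics.KineticTheory.T3 → Literature.MathematicalPhysics.KineticTheory.V3) (ρh θh : ℝ → ℝ → Literature.MathematicalPhysics.KineticTheory.T3 → ℝ) (uh : ℝ → ℝ → Literature.MathematicalPhysics.KineticTheory.T3 → Literature.MathematicalPhysics.KineticTheory.V3), Literature.Analysis.FunctionSpaces.Torus.IsSmoothSpaceTimeOn (Set.Icc 0 1) a ∧ Literature.Analysis.FunctionSpaces.Torus.IsSmoothSpaceTimeOn (Set.Icc 0 1) θ₀ ∧ Literature.Analysis.FunctionSpaces.Torus.IsSmoothSpaceTimeOn (Set.Icc 0 1) u₀ ∧ (∀ κ ∈ Set.Icc (0 : ℝ) 1, ∀ x, Λ⁻¹ * (⨅ y, a₁ y) ≤ a κ x ∧ a κ x ≤ Λ * (⨆ y, a₁ y) ∧ 0 < θ₀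 κ x) ∧ (∀ x, a 0 x = a 0 0 ∧ θ₀ 0 x = θ₀ 0 0 ∧ u₀ 0 x = u₀ 0 0) ∧ a 1 = a₁ ∧ θ₀ 1 = θ₁ ∧ u₀ 1 = u₁ ∧ (∀ κ ∈ Set.Icc (0 : ℝ) 1, Literature.MathematicalPhysics.KineticTheory.IsHardSphereEulerSolution σ T' (ρh κ) (uh κ) (θh κ)) ∧ ContDiffOn ℝ ((⊤ : ℕ∞) : WithTop ℕ∞) (fun q : ℝ × ℝ × EuclideanSpace ℝ (Fin 3) => ρh q.1 q.2.1 (Literature.Analysis.FunctionSpaces.Torus.proj q.2.2)) (Set.Icc 0 1 ×ˢ (Set.Ico 0 T' ×ˢ Set.univ)) ∧ ContDiffOn ℝ ((⊤ : ℕ∞) : WithTop ℕ∞) (fun q : ℝ × ℝ × EuclideanSpace ℝ (Fin 3) => uh q.1 q.2.1 (Literature.Analysis.FunctionSpaces.Torus.proj q.2.2)) (Set.Icc 0 1 ×ˢ (Set.Ico 0 T' ×ˢ Set.univ)) ∧ ContDiffOn ℝ ((⊤ : ℕ∞) : WithTop ℕ∞) (fun q : ℝ × ℝ × EuclideanSpace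 ℝ (Fin 3) => θh q.1 q.2.1 (Literature.Analysis.FunctionSpaces.Torus.proj q.2.2)) (Set.Icc 0 1 ×ˢ (Set.Ico 0 T' ×ˢ Set.univ)) ∧ (∀ κ ∈ Set.Icc (0 : ℝ) 1, Literature.MathematicalPhysics.KineticTheory.TendstoHydroFieldsAt (fun N => Literature.MathematicalPhysics.KineticTheory.localGibbsLaw σ (a κ) (u₀ κ) (θ₀ κ) N (Φ N)) Φ (ρh κ) (uh κ) (θh κ) 0) ∧ (∀ κ ∈ Set.Icc (0 : ℝ) 1, ∀ N, MeasureTheory.IsProbabilityMeasure (Literature.MathematicalPhysics.KineticTheory.localGibbsLaw σ (a κ) (u₀ κ) (θ₀ κ) N (Φ N))) ∧ ρh 1 = ρ ∧ uh 1 = u ∧ θh 1 = θ ∧ (∀ s ∈ Set.Ico 0 T', ∀ x, ρh 0 s x = ρh 0 0 0 ∧ uh 0 s x = uh 0 0 0 ∧ θh 0 s x = θh 0 0 0)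

-- `PreShockHomotopy` holds: proved by `Summit.AtomisticToContinuum.HydrodynamicLimit.Theorems.PreShockDoor.preShockHomotopy_holds` (its module imports this route file, so no `_holds` link can be stated here).

-- earlier MeanVarianceReduction (stmt-AtomisticToContinuum-15139, replaced 2026-08-16T23:35:54Z -> stmt-AtomisticToContinuum-17778): proved by Summit.AtomisticToContinuum.HydrodynamicLimit.Theorems.oneSphereInfluence_meanVarianceReduction @ 94bbdb1f4182 — ScoreLinearResponse → ResamplingInfluence → HardCorePoincare → PreShockHomotopy → _root_.HydrodynamicLimit
/-- item stmt-AtomisticToContinuum-17778 · crux · rank 9 · closed · proved by Summit.AtomisticToContinuum.HydrodynamicLimit.Theorems.oneSphereInfluence_meanVarianceReduction (prover) · by planner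
why it might fail: Crux BY RULE (glue of closes), routine; fails only AS TYPED (score identity under the canonical integral, κ=0 uniform integrability, covariance/condVar/derivWithin junk) — and its verbatim proof is in tree (oneSphereInfluence_meanVarianceReduction), so the residual risk is nil.
sources: LastPenrose2017 Thm 19.1, EfronStein1981, Chatterjee2016, OllaVaradhanYau1993 §1, Spohn1991
[crux] MEAN–VARIANCE REDUCTION (crux BY RULE, D-0027 §2.1: every unproved hypothesis of the deciding
theorem is a crux; this is the route's glue, routine in kind): the three one-sphere statements and
the pre-shock homotopy imply the UNGUARDED hard-sphere Euler limit
`Literature.MathematicalPhysics.KineticTheory.HydrodynamicLimit`; `closes` then reaches the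
(packing-guarded) conjunct `_root_.HydrodynamicLimit` by `HydrodynamicLimit.of_unguarded`. RESTATED
2026-08-16 after the statement re-type p126922 (D-0032): the previous body `… →
_root_.HydrodynamicLimit` (stmt-15139, proved @ 14dc9d5365a6) had by name become the guarded
conjunct, under which its landed proof (Theorems.oneSphereInfluence_meanVarianceReduction := fun h₂
h₃ h₄ hP => oneSphereInfluence_assembly h₂ h₃ h₄ HomogeneousInvariance_holds hP, through the
assembly whose script introduces the old ∀-prefix) no longer elaborates; with this conclusion both
proof files compile UNCHANGED (checked verbatim: SketchAssemblyU.lean, farm rc 0). Proof = Assembly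
with the PROVED HomogeneousInvariance discharged; content = MeanVarianceL2 (finite-N score identity,
FTC in κ along the homotopy anchored at the flow-invariant constant state, -/
@[route_item "route-AtomisticToContinuum-OneSphereInfluence", crux]
def MeanVarianceReduction : Prop :=
  ScoreLinearResponse → ResamplingInfluence → HardCorePoincare → PreShockHomotopy → Literature.MathematicalPhysics.KineticTheory.HydrodynamicLimit

-- `MeanVarianceReduction` holds: proved by `Summit.AtomisticToContinuum.HydrodynamicLimit.Theorems.oneSphereInfluence_meanVarianceReduction` (its module imports this route file, so no `_holds` link can be stated here).

/-- item stmt-AtomisticToContinuum-9621 · support · rank 5 · closed · proved by Summit.AtomisticToContinuum.HydrodynamicLimit.Theorems.homogeneousInvariance_proof @ ed8325cc54bb (prover) · by planner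
sources: GST2013, CIP1994, Alexander1975
[support] (= stmt-AtomisticToContinuum-3073 verbatim, shared with OneParticleInfluence /
HomoenergeticRung) the canonical law with constant profiles is invariant under every hard-sphere
flow, lawAt Φ p t = p (Liouville preservation + energy and momentum conservation on the good set;
rests on PROVED cone facts). Gives E_G[X_t] = E_G[X_0] = the equilibrium values subtracted in
SoundWindow. [difficulty: provable-now] -/
@[route_item "route-AtomisticToContinuum-OneSphereInfluence"]
def HomogeneousInvariance : Prop :=
  ∀ (σ c θc : ℝ) (uc : Literature.MathematicalPhysics.KineticTheory.V3), 0 < σ → 0 < c → 0 < θc → ∀ (N : ℕ) (Φ : Literature.Analysis.FluidPDE.HardSphereFlow (Literature.Analysis.FluidPDE.Torus.geometry (Fin 3)) (Literature.MathematicalPhysics.KineticTheory.hsDiameter σ N) (N + 1)) (t : ℝ), Φ.lawAt (Literature.MathematicalPhysics.KineticTheory.localGibbsLaw σ (fun _ => c) (fun _ => uc) (fun _ => θc) N Φ) t = Literature.MathematicalPhysics.KineticTheory.localGibbsLaw σ (fun _ => c) (fun _ => uc) (fun _ => θc) N Φ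

/-- `HomogeneousInvariance` holds: proved by `Summit.AtomisticToContinuum.HydrodynamicLimit.Theorems.homogeneousInvariance_proof` @ ed8325cc54bb. -/
theorem HomogeneousInvariance_holds : HomogeneousInvariance := _root_.Summit.AtomisticToContinuum.HydrodynamicLimit.Theorems.homogeneousInvariance_proof

/-- item stmt-AtomisticToContinuum-12106 · support · rank 9 · open · by planner
sources: Spohn1991, EvansMorriss2008, Resibois1978
[crux] K2 (card K2; the five-charge sector of the bootstrap, hydrodynamic poles projected out):
Euler-scale LINEAR RESPONSE of the equilibrium hard-sphere gas at fixed small σ is linearised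
hs-Euler — along a smooth homotopy of local-Gibbs profiles starting at a constant state, with a
jointly smooth family of classical hs-Euler solutions matching the LLN data, the covariance under
the homogeneous canonical Gibbs law of the initial score Σ_i ∂_κ log(profile_κ)(z_i) at κ = 0 with
the time-t empirical density / momentum / energy field tested against χ converges to ∂_κ|₀ of the
corresponding Euler field (Landau–Placzek structure; Drude weights of the fast currents zero;
Spohn1991 Part II §7 in response form). Same normalised signature as stmt-3075 (OneParticleInfluence
/ LaceRingBootstrap): this route wants it as a CRUX because it is exactly the output of the small-z
bootstrap in the sector orthogonal to the five charges. [deps: EquilibriumVafEnvelope,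
EquilibriumRecollisionBound] [difficulty: open-problem] -/
@[route_item "route-AtomisticToContinuum-OneSphereInfluence"]
def EquilibriumLinearResponse : Prop :=
  ∀ (a₁ θ₁ : Literature.MathematicalPhysics.KineticTheory.T3 → ℝ) (u₁ : Literature.MathematicalPhysics.KineticTheory.T3 → Literature.MathematicalPhysics.KineticTheory.V3), Continuous a₁ → Continuous θ₁ → Continuous u₁ → (∀ x, 0 < a₁ x) → (∀ x, 0 < θ₁ x) → ∀ Λ : ℝ, 1 ≤ Λ → ∃ σ₀ : ℝ, 0 < σ₀ ∧ ∀ σ : ℝ, 0 < σ → σ < σ₀ → ∀ (a θ₀ : ℝ → Literature.MathematicalPhysics.KineticTheory.T3 → ℝ) (u₀ : ℝ → Literature.MathematicalPhysics.KineticTheory.T3 → Literature.MathematicalPhysics.KineticTheory.V3), Literature.Analysis.FunctionSpaces.Torus.IsSmoothSpaceTimeOn (Set.Icc 0 1) a → Literature.Analysis.FunctionSpaces.Torus.IsSmoothSpaceTimeOn (Set.Icc 0 1) θ₀ → Literature.Analysis.FunctionSpaces.Torus.IsSmoothSpaceTimeOn (Set.Icc 0 1) u₀ → (∀ κ ∈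 Set.Icc (0 : ℝ) 1, ∀ x, Λ⁻¹ * (⨅ y, a₁ y) ≤ a κ x ∧ a κ x ≤ Λ * (⨆ y, a₁ y) ∧ 0 < θ₀ κ x) → (∀ x, a 0 x = a 0 0 ∧ θ₀ 0 x = θ₀ 0 0 ∧ u₀ 0 x = u₀ 0 0) → a 1 = a₁ → θ₀ 1 = θ₁ → u₀ 1 = u₁ → ∀ (T : ℝ) (ρ θ : ℝ → ℝ → Literature.MathematicalPhysics.KineticTheory.T3 → ℝ) (u : ℝ → ℝ → Literature.MathematicalPhysics.KineticTheory.T3 → Literature.MathematicalPhysics.KineticTheory.V3), (∀ κ ∈ Set.Icc (0 : ℝ) 1, Literature.MathematicalPhysics.KineticTheory.IsHardSphereEulerSolution σ T (ρ κ) (u κ) (θ κ)) → ContDiffOn ℝ ((⊤ : ℕ∞) : WithTop ℕ∞) (fun q : ℝ × ℝ × EuclideanSpace ℝ (Fin 3) => ρ q.1 q.2.1 (Literature.Analysis.FunctionSpaces.Torus.proj q.2.2)) (Set.Icc 0 1 ×ˢ (Set.Ico 0 T ×ˢ Set.univ)) → ContDiffOn ℝ ((⊤ : ℕ∞) : WithTop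 ℕ∞) (fun q : ℝ × ℝ × EuclideanSpace ℝ (Fin 3) => u q.1 q.2.1 (Literature.Analysis.FunctionSpaces.Torus.proj q.2.2)) (Set.Icc 0 1 ×ˢ (Set.Ico 0 T ×ˢ Set.univ)) → ContDiffOn ℝ ((⊤ : ℕ∞) : WithTop ℕ∞) (fun q : ℝ × ℝ × EuclideanSpace ℝ (Fin 3) => θ q.1 q.2.1 (Literature.Analysis.FunctionSpaces.Torus.proj q.2.2)) (Set.Icc 0 1 ×ˢ (Set.Ico 0 T ×ˢ Set.univ)) → ∀ Φ : (N : ℕ) → Literature.Analysis.FluidPDE.HardSphereFlow (Literature.Analysis.FluidPDE.Torus.geometry (Fin 3)) (Literature.MathematicalPhysics.KineticTheory.hsDiameter σ N) (N + 1), (∀ κ ∈ Set.Icc (0 : ℝ) 1, Literature.MathematicalPhysics.KineticTheory.TendstoHydroFieldsAt (fun N => Literature.MathematicalPhysics.KineticTheory.localGibbsLaw σ (a κ) (u₀ κ) (θ₀ κ) N (Φ N)) Φ (ρ κ) (u κ) (θ κ) 0) → ∀ t ∈ Set.Ico 0 T, ∀ χ : Literature.MathematicalPhysics.KineticTheory.T3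 → ℝ, Continuous χ → let p : ℝ → (N : ℕ) → MeasureTheory.Measure (Literature.Analysis.FluidPDE.Config (N + 1) (Fin 3) Literature.MathematicalPhysics.KineticTheory.T3) := fun κ N => Literature.MathematicalPhysics.KineticTheory.localGibbsLaw σ (a κ) (u₀ κ) (θ₀ κ) N (Φ N); let S : ℝ → (N : ℕ) → Literature.Analysis.FluidPDE.Config (N + 1) (Fin 3) Literature.MathematicalPhysics.KineticTheory.T3 → ℝ := fun κ N z => ∑ i, derivWithin (fun κ' => Real.log (Literature.MathematicalPhysics.KineticTheory.localGibbsProfile (a κ') (u₀ κ') (θ₀ κ') (z i))) (Set.Icc 0 1) κ; Filter.Tendsto (fun N : ℕ => ProbabilityTheory.covariance (S 0 N) (fun z => Literature.MathematicalPhysics.KineticTheory.empiricalDensityField ((Φ N).flow t z) χ) (p 0 N)) Filter.atTop (nhds (derivWithin (fun κ' => ∫ x, χ x * ρ κ' t x) (Set.Icc 0 1) 0)) ∧ (∀ j : Fin 3, Filter.Tendsto (fun N : ℕ => ProbabilityTheory.covariance (S 0 N) (fun z => Literature.MathematicalPhysics.KineticTheory.empiricalMomentumField ((Φ N).flow t z)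 χ j) (p 0 N)) Filter.atTop (nhds (derivWithin (fun κ' => ∫ x, χ x * ρ κ' t x * u κ' t x j) (Set.Icc 0 1) 0))) ∧ Filter.Tendsto (fun N : ℕ => ProbabilityTheory.covariance (S 0 N) (fun z => Literature.MathematicalPhysics.KineticTheory.empiricalEnergyField ((Φ N).flow t z) χ) (p 0 N)) Filter.atTop (nhds (derivWithin (fun κ' => ∫ x, χ x * Literature.MathematicalPhysics.KineticTheory.totalEnergyDensity (ρ κ' t x) (u κ' t x) (θ κ' t x)) (Set.Icc 0 1) 0))

/-- item stmt-AtomisticToContinuum-12269 · support · rank 9 · open · by planner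
sources: Ruelle1969, LebowitzPenrose1964, HelmuthPerkinsPetti2022, MichelenPerkins2022
[support] (= stmt-AtomisticToContinuum-3074 verbatim, shared with the retired OneParticleInfluence)
t = 0 static score response along the profile path: if (ρ₀ κ, u₀ κ, θ₀ κ) are the LLN fields of the
κ-data (hypothesis), then Cov_(p_κ)(S_κ, ⟨U_N(0),χ⟩) → ∂_κ of the limiting fields tested with χ,
uniformly in κ ∈ [0,1], for the density, momentum and energy fields (cluster expansion at small
packing: differentiability of the canonical one-point density in the activity profile uniformly in
N; Gaussian velocity parts). Used in the Assembly with the κ-dependent test functions h⃗^κ via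
linearity, a finite κ-net and the equicontinuity bound |Cov(S_κ,⟨U_N(0),g⟩)| ≤ C‖g‖_∞ from
StaticFluctuationBounds. [difficulty: M] -/
@[route_item "route-AtomisticToContinuum-OneSphereInfluence"]
def StaticScoreResponse : Prop :=
  ∀ (a₁ θ₁ : Literature.MathematicalPhysics.KineticTheory.T3 → ℝ) (u₁ : Literature.MathematicalPhysics.KineticTheory.T3 → Literature.MathematicalPhysics.KineticTheory.V3), Continuous a₁ → Continuous θ₁ → Continuous u₁ → (∀ x, 0 < a₁ x) → (∀ x, 0 < θ₁ x) → ∀ Λ : ℝ, 1 ≤ Λ → ∃ σ₀ : ℝ, 0 < σ₀ ∧ ∀ σ : ℝ, 0 < σ → σ < σ₀ → ∀ (a θ₀ : ℝ → Literature.MathematicalPhysics.KineticTheory.T3 → ℝ) (u₀ : ℝ → Literature.MathematicalPhysics.KineticTheory.T3 → Literature.MathematicalPhysics.KineticTheory.V3), Literature.Analysis.FunctionSpaces.Torus.IsSmoothSpaceTimeOn (Set.Icc 0 1) a → Literature.Analysis.FunctionSpaces.Torus.IsSmoothSpaceTimeOn (Set.Icc 0 1) θ₀ → Literature.Analysis.FunctionSpaces.Torus.IsSmoothSpaceTimeOn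 (Set.Icc 0 1) u₀ → (∀ κ ∈ Set.Icc (0 : ℝ) 1, ∀ x, Λ⁻¹ * (⨅ y, a₁ y) ≤ a κ x ∧ a κ x ≤ Λ * (⨆ y, a₁ y) ∧ 0 < θ₀ κ x) → ∀ ρ₀ : ℝ → Literature.MathematicalPhysics.KineticTheory.T3 → ℝ, Literature.Analysis.FunctionSpaces.Torus.IsSmoothSpaceTimeOn (Set.Icc 0 1) ρ₀ → ∀ Φ : (N : ℕ) → Literature.Analysis.FluidPDE.HardSphereFlow (Literature.Analysis.FluidPDE.Torus.geometry (Fin 3)) (Literature.MathematicalPhysics.KineticTheory.hsDiameter σ N) (N + 1), (∀ κ ∈ Set.Icc (0 : ℝ) 1, Literature.MathematicalPhysics.KineticTheory.TendstoHydroFieldsAt (fun N => Literature.MathematicalPhysics.KineticTheory.localGibbsLaw σ (a κ) (u₀ κ) (θ₀ κ) N (Φ N)) Φ (fun _ => ρ₀ κ) (fun _ => u₀ κ) (fun _ => θ₀ κ) 0) → ∀ χ : Literature.MathematicalPhysics.KineticTheory.T3 → ℝ, Continuous χ → let p : ℝ → (N : ℕ) → MeasureTheory.Measure (Literature.Analysis.FluidPDE.Config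 (N + 1) (Fin 3) Literature.MathematicalPhysics.KineticTheory.T3) := fun κ N => Literature.MathematicalPhysics.KineticTheory.localGibbsLaw σ (a κ) (u₀ κ) (θ₀ κ) N (Φ N); let S : ℝ → (N : ℕ) → Literature.Analysis.FluidPDE.Config (N + 1) (Fin 3) Literature.MathematicalPhysics.KineticTheory.T3 → ℝ := fun κ N z => ∑ i, derivWithin (fun κ' => Real.log (Literature.MathematicalPhysics.KineticTheory.localGibbsProfile (a κ') (u₀ κ') (θ₀ κ') (z i))) (Set.Icc 0 1) κ; TendstoUniformlyOn (fun N κ => ProbabilityTheory.covariance (S κ N) (fun z => Literature.MathematicalPhysics.KineticTheory.empiricalDensityField z χ) (p κ N)) (fun κ => derivWithin (fun κ' => ∫ x, χ x * ρ₀ κ' x) (Set.Icc 0 1) κ) Filter.atTop (Set.Icc 0 1) ∧ (∀ j : Fin 3, TendstoUniformlyOn (fun N κ => ProbabilityTheory.covariance (S κ N) (fun z => Literature.MathematicalPhysics.KineticTheory.empiricalMomentumField z χ j) (p κ N)) (fun κ => derivWithin (fun κ' => ∫ x, χ x * ρ₀ κ' x * u₀ κ' x j) (Set.Icc 0 1)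 κ) Filter.atTop (Set.Icc 0 1)) ∧ TendstoUniformlyOn (fun N κ => ProbabilityTheory.covariance (S κ N) (fun z => Literature.MathematicalPhysics.KineticTheory.empiricalEnergyField z χ) (p κ N)) (fun κ => derivWithin (fun κ' => ∫ x, χ x * Literature.MathematicalPhysics.KineticTheory.totalEnergyDensity (ρ₀ κ' x) (u₀ κ' x) (θ₀ κ' x)) (Set.Icc 0 1) κ) Filter.atTop (Set.Icc 0 1)

/-- item stmt-AtomisticToContinuum-13620 · support · rank 9 · open · by planner
sources: Spohn1991, Duerinckx2021, EvansMorriss2008, AlderWainwright1970, Kato1975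
[support] ONE-PARTICLE GREEN'S-FUNCTION RESPONSE (the card's headline object, typed now that
defn-LinearizedHsEuler landed; foreseen layer-2 child of ScoreLinearResponse): in the setting of
ScoreLinearResponse, for t < T, continuous χ, k ∈ Fin 5 and any κ-family ψ_κ of backward ADJOINT
linearised hs-Euler solutions around U_κ on [0,t] with ψ_κ(t) = χ e_k, the conditional mean response
of the time-t field to sphere 0, m_t(z₀) = E_κ[F^k_t | z₀] − E_κ F^k_t, equals the time-0
conditional response tested against the back-propagated field, m̃_0(z₀) = E_κ[⟨U_N(0), ψ_κ(0)⟩ | z₀]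
− E_κ⟨U_N(0), ψ_κ(0)⟩, up to o(1/N) in L²(p_κ): (N+1)²·E_κ|m_t − m̃_0|² → 0 uniformly in κ. By the
PROVED duality ∫χV(t)_k = ∫⟪V(0),ψ(0)⟫ this is m_t = 𝒢^κ_t[m_0] + o(1/N): the fluid remembers where
one molecule started only through linearised-Euler (sound + entropy) transport of its DRESSED static
imprint (the exact time-0 conditional response). With StaticScoreResponse, Cauchy–Schwarz against
the score, exchangeability and the proved hasDerivWithinAt_integral_response it yields
ScoreLinearResponse, given adjoint solvability (layer 2). Free flight fails it (ballistic memory of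
v₀). [difficulty: open-problem] -/
@[route_item "route-AtomisticToContinuum-OneSphereInfluence"]
def OneParticleGreenResponse : Prop :=
  ∀ (a₁ θ₁ : Literature.MathematicalPhysics.KineticTheory.T3 → ℝ) (u₁ : Literature.MathematicalPhysics.KineticTheory.T3 → Literature.MathematicalPhysics.KineticTheory.V3), Continuous a₁ → Continuous θ₁ → Continuous u₁ → (∀ x, 0 < a₁ x) → (∀ x, 0 < θ₁ x) → ∀ Λ : ℝ, 1 ≤ Λ → ∃ σ₀ : ℝ, 0 < σ₀ ∧ ∀ σ : ℝ, 0 < σ → σ < σ₀ → ∀ (a θ₀ : ℝ → Literature.MathematicalPhysics.KineticTheory.T3 → ℝ) (u₀ : ℝ → Literature.MathematicalPhysics.KineticTheory.T3 → Literature.MathematicalPhysics.KineticTheory.V3), Literature.Analysis.FunctionSpaces.Torus.IsSmoothSpaceTimeOn (Icc 0 1) a → Literature.Analysis.FunctionSpaces.Torus.IsSmoothSpaceTimeOn (Icc 0 1) θ₀ → Literature.Analysis.FunctionSpaces.Torus.IsSmoothSpaceTimeOn (Icc 0 1) u₀ → (∀ κ ∈ Icc (0 : ℝ) 1, ∀ x,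 Λ⁻¹ * (⨅ y, a₁ y) ≤ a κ x ∧ a κ x ≤ Λ * (⨆ y, a₁ y) ∧ 0 < θ₀ κ x) → (∀ x, a 0 x = a 0 0 ∧ θ₀ 0 x = θ₀ 0 0 ∧ u₀ 0 x = u₀ 0 0) → a 1 = a₁ → θ₀ 1 = θ₁ → u₀ 1 = u₁ → ∀ (T : ℝ) (ρ θ : ℝ → ℝ → Literature.MathematicalPhysics.KineticTheory.T3 → ℝ) (u : ℝ → ℝ → Literature.MathematicalPhysics.KineticTheory.T3 → Literature.MathematicalPhysics.KineticTheory.V3), (∀ κ ∈ Icc (0 : ℝ) 1, Literature.MathematicalPhysics.KineticTheory.IsHardSphereEulerSolution σ T (ρ κ) (u κ) (θ κ)) → ContDiffOn ℝ ((⊤ : ℕ∞) : WithTop ℕ∞) (fun q : ℝ × ℝ × EuclideanSpace ℝ (Fin 3) => ρ q.1 q.2.1 (Literature.Analysis.FunctionSpaces.Torus.proj q.2.2)) (Icc 0 1 ×ˢ (Ico 0 T ×ˢ univ)) → ContDiffOn ℝ ((⊤ : ℕ∞) : WithTop ℕ∞) (fun q : ℝ × ℝ × EuclideanSpace ℝ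 (Fin 3) => u q.1 q.2.1 (Literature.Analysis.FunctionSpaces.Torus.proj q.2.2)) (Icc 0 1 ×ˢ (Ico 0 T ×ˢ univ)) → ContDiffOn ℝ ((⊤ : ℕ∞) : WithTop ℕ∞) (fun q : ℝ × ℝ × EuclideanSpace ℝ (Fin 3) => θ q.1 q.2.1 (Literature.Analysis.FunctionSpaces.Torus.proj q.2.2)) (Icc 0 1 ×ˢ (Ico 0 T ×ˢ univ)) → ∀ Φ : (N : ℕ) → Literature.Analysis.FluidPDE.HardSphereFlow (Literature.Analysis.FluidPDE.Torus.geometry (Fin 3)) (Literature.MathematicalPhysics.KineticTheory.hsDiameter σ N) (N + 1), (∀ κ ∈ Icc (0 : ℝ) 1, Literature.MathematicalPhysics.KineticTheory.TendstoHydroFieldsAt (fun N => Literature.MathematicalPhysics.KineticTheory.localGibbsLaw σ (a κ) (u₀ κ) (θ₀ κ) N (Φ N)) Φ (ρ κ) (u κ) (θ κ) 0) → ∀ t ∈ Ico 0 T, ∀ χ : Literature.MathematicalPhysics.KineticTheory.T3 → ℝ, Continuous χ → ∀ k : Fin 5, ∀ ψ : ℝ → ℝ → Literature.MathematicalPhysics.KineticTheory.T3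 → Literature.Analysis.FluidPDE.HsState, (∀ κ ∈ Icc (0 : ℝ) 1, Literature.Analysis.FluidPDE.IsAdjointLinearizedHsEulerSolution σ t (ρ κ) (u κ) (θ κ) (ψ κ)) → (∀ κ ∈ Icc (0 : ℝ) 1, ∀ x, ψ κ t x = χ x • EuclideanSpace.single k 1) → let p := fun (κ : ℝ) (N : ℕ) => Literature.MathematicalPhysics.KineticTheory.localGibbsLaw σ (a κ) (u₀ κ) (θ₀ κ) N (Φ N); let m₀ := fun (N : ℕ) => MeasurableSpace.comap (fun z : Literature.Analysis.FluidPDE.Config (N + 1) (Fin 3) Literature.MathematicalPhysics.KineticTheory.T3 => z 0) inferInstance; let Ft := fun (N : ℕ) (z : Literature.Analysis.FluidPDE.Config (N + 1) (Fin 3) Literature.MathematicalPhysics.KineticTheory.T3) => ∫ y, inner ℝ (χ y.1 • EuclideanSpace.single k 1) (Literature.Analysis.FluidPDE.HsState.mk 1 y.2 (‖y.2‖ ^ 2 / 2)) ∂Literature.Analysis.FluidPDE.empiricalMeasure ((Φ N).flow t z); let G₀ := fun (κ : ℝ) (N : ℕ) (z : Literature.Analysis.FluidPDE.Config (N + 1)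 (Fin 3) Literature.MathematicalPhysics.KineticTheory.T3) => ∫ y, inner ℝ (ψ κ 0 y.1) (Literature.Analysis.FluidPDE.HsState.mk 1 y.2 (‖y.2‖ ^ 2 / 2)) ∂Literature.Analysis.FluidPDE.empiricalMeasure z; TendstoUniformlyOn (fun (N : ℕ) (κ : ℝ) => ((N : ℝ) + 1) ^ 2 * ∫ z, (condExp (m₀ N) (p κ N) (Ft N) z - (∫ w, Ft N w ∂(p κ N)) - (condExp (m₀ N) (p κ N) (G₀ κ N) z - ∫ w, G₀ κ N w ∂(p κ N))) ^ 2 ∂(p κ N)) (fun _ => (0 : ℝ)) atTop (Icc 0 1)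

/-- item stmt-AtomisticToContinuum-13622 · support · rank 9 · closed · proved by Summit.AtomisticToContinuum.HydrodynamicLimit.Theorems.oneSphereInfluence_meanVarianceL2 @ 94bbdb1f4182 (prover) · by planner
sources: Spohn1991, OllaVaradhanYau1993, LastPenrose2017
[support] THE GLUE OF THIS ROUTE (kind glue, filed as support; the mathematics between cruxes and
target that the retired gen-1 route lacked): take Λ from PreShockHomotopy and σ₀ = min of the four
antecedents' σ₀; for σ < σ₀, a classical solution on [0,T), flows Φ, the t = 0 hypothesis and t < T:
PreShockHomotopy gives T' > t, the path and the Euler family with exactly the hypotheses of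
ScoreLinearResponse; the finite-N SCORE IDENTITY d/dκ E_{p_κ}F_t = Cov_{p_κ}(S_κ, F_t) (Z_κ > 0 from
the IsProbabilityMeasure clause; differentiation under the integral with Gaussian domination, the
hard-core indicator being κ-independent), FTC in κ and the UNIFORM limit give E_{p_1}F_t −
E_{p_0}F_t → ⟨U_1(t),χ⟩ − ⟨U_0(t),χ⟩; HomogeneousInvariance and the κ = 0 LLN at time 0 with uniform
integrability (bounded χ, Gaussian velocity moments, conserved kinetic energy) give E_{p_0}F_t =
E_{p_0}F_0 → ⟨U_0(0),χ⟩ = ⟨U_0(t),χ⟩ (constant member); HardCorePoincare (MemLp 2 by energy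
conservation) and ResamplingInfluence give Var_{p_1}(F_t) → 0; E|F_t − c|² = Var + (E F_t − c)² → 0,
converted to the lintegral of ofReal(|·|²). Measure theory + one κ-integration; no physics.
[difficulty: M] -/
@[route_item "route-AtomisticToContinuum-OneSphereInfluence"]
def MeanVarianceL2 : Prop :=
  ScoreLinearResponse → ResamplingInfluence → HardCorePoincare → HomogeneousInvariance → PreShockHomotopy → L2HydroFields

-- `MeanVarianceL2` holds: proved by `Summit.AtomisticToContinuum.HydrodynamicLimit.Theorems.oneSphereInfluence_meanVarianceL2` @ 94bbdb1f4182 (its module imports this route file, so no `_holds` link can be stated here).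

/-- item stmt-AtomisticToContinuum-9171 · support · rank 9 · closed · proved by Summit.AtomisticToContinuum.HydrodynamicLimit.Theorems.l2ToHydroLimit_proof_oneSphereInfluence @ 3b05a3a414f8 (prover) · by planner
sources: OllaVaradhanYau1993, Spohn1991
[support] Chebyshev glue with the ROOT-LEVEL conclusion (the sub-problem Statement decl
`HydrodynamicLimit`, an abbrev of the Literature constant; the proof attached to
stmt-AtomisticToContinuum-0801 applies verbatim up to `show`): mean-square convergence of the fields
implies convergence in probability, profile by profile (meas_ge_le_lintegral_div, measurability from
measurable_flow + continuity of χ). [difficulty: provable-now] -/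
@[route_item "route-AtomisticToContinuum-OneSphereInfluence"]
def L2ToHydroLimit : Prop :=
  L2HydroFields → _root_.HydrodynamicLimit

-- `L2ToHydroLimit` holds: proved by `Summit.AtomisticToContinuum.HydrodynamicLimit.Theorems.l2ToHydroLimit_proof_oneSphereInfluence` @ 3b05a3a414f8 (its module imports this route file, so no `_holds` link can be stated here).

-- earlier Assembly (stmt-AtomisticToContinuum-13623, replaced 2026-08-16T06:09:57Z -> stmt-AtomisticToContinuum-14700): retired by None — MeanVarianceL2 → L2ToHydroLimit → ScoreLinearResponse → ResamplingInfluence → HardCorePoincare → HomogeneousInvariance → PreShockHomotopy → _root_.HydrodynamicLimit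
-- earlier Assembly (stmt-AtomisticToContinuum-14700, replaced 2026-08-16T23:34:57Z -> stmt-AtomisticToContinuum-17765): proved by Summit.AtomisticToContinuum.HydrodynamicLimit.Theorems.oneSphereInfluence_assembly @ 1c20aa975f44 — ScoreLinearResponse → ResamplingInfluence → HardCorePoincare → HomogeneousInvariance → PreShockHomotopy → _root_.HydrodynamicLimit
/-- item stmt-AtomisticToContinuum-17765 · assembly · rank 1 · closed · proved by Summit.AtomisticToContinuum.HydrodynamicLimit.Theorems.oneSphereInfluence_assembly (prover) · by planner
sources: Spohn1991, OllaVaradhanYau1993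
[assembly] ScoreLinearResponse → ResamplingInfluence → HardCorePoincare → HomogeneousInvariance →
PreShockHomotopy → Literature.MathematicalPhysics.KineticTheory.HydrodynamicLimit (the UNGUARDED
hard-sphere Euler limit = the pre-retype conjunct): the three one-sphere cruxes and the two
anchoring statements imply the unguarded hydrodynamic limit. RESTATED 2026-08-16 after the statement
re-type p126922 (D-0032): by name the previous body `… → _root_.HydrodynamicLimit` (stmt-14700,
proved @ ea772df2db51) had silently become the weaker PACKING-GUARDED conjunct, under which the
landed proof script Theorems.oneSphereInfluence_assembly (OneSphereInfluenceAssembly.lean: `intro hS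
hR hH hI hP a₁ θ₁ u₁ …`, no guard binder) no longer elaborates; with the unguarded conclusion that
file — and OneSphereInfluenceMeanVarianceL2.lean / OneSphereInfluenceMeanVarianceReduction.lean,
which import it — compile UNCHANGED (checked: the verbatim proof against this body,
SketchAssemblyU.lean, farm rc 0, 0 sorries). This route's cruxes carry no packing guard, so its glue
proves the unguarded limit; the conjunct follows inside `closes` by the Statement's bridge
`HydrodynamicLimit.of_unguarded`. Mathematical -/
@[route_item "route-AtomisticToContinuum-OneSphereInfluence"]
def Assembly : Prop :=
  ScoreLinearResponse → ResamplingInfluence → HardCorePoincare → HomogeneousInvariance → PreShockHomotopy → Literature.MathematicalPhysics.KineticTheory.HydrodynamicLimit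

-- `Assembly` holds: proved by `Summit.AtomisticToContinuum.HydrodynamicLimit.Theorems.oneSphereInfluence_assembly` (its module imports this route file, so no `_holds` link can be stated here).

/-! D-0027 §2.1 — DECIDING THEOREM (planner-authored via `route open/edit --closes-file`; by planner-rrepair-AtomisticToContinuum-OneSphere-54bcc7f8-0 2026-08-16T23:35:54Z):
its hypotheses are this route's items and its conclusion the sub-problem Statement (glue_lint), and it elaborates with this file. -/

/-- D-0027 §2.1 deciding theorem of route `OneSphereInfluence` (card one-particle-influence), RE-TYPED
2026-08-16 after the D-0032 statement re-type (p126922): the sub-problem decl `_root_.HydrodynamicLimit`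
is now the PACKING-GUARDED hard-sphere Euler limit (∃ η₀ outermost; guard ρ_t(x)σ³ < η₀ on [0,T)×𝕋³).
This route's cruxes carry no packing guard, and its rule-crux `MeanVarianceReduction` — the route's glue
(score identity + FTC in κ anchored at the flow-invariant constant state for the mean, HardCorePoincare ×
ResamplingInfluence for the variance, Chebyshev), whose proof is in tree
(`Theorems.oneSphereInfluence_meanVarianceReduction`) — concludes the UNGUARDED Literature conjecture
`Literature.MathematicalPhysics.KineticTheory.HydrodynamicLimit`; the conjunct follows by the Statement's
own bridge `HydrodynamicLimit.of_unguarded` (take any η₀, ignore the guard). Hypotheses = the four cruxes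
+ the rule-crux, all crux items; the new guard hypothesis is supplied vacuously, no new item. -/
@[closes "route-AtomisticToContinuum-OneSphereInfluence"] theorem closes (h₂ : ScoreLinearResponse) (h₃ : ResamplingInfluence) (h₄ : HardCorePoincare)
    (hP : PreShockHomotopy) (hR : MeanVarianceReduction) : _root_.HydrodynamicLimit :=
  _root_.HydrodynamicLimit.of_unguarded (hR h₂ h₃ h₄ hP)

end Summit.AtomisticToContinuum.HydrodynamicLimit.Theses.OneSphereInfluence
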